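import Mathlib
import Summits.KontsevichZagierPeriods.KontsevichZagierPeriods.Theses.SymplecticScissors
import Summits.KontsevichZagierPeriods.KontsevichZagierPeriods.Theorems.SymplecticScissorsPlanarSAZylevStubTeSymm
import Summits.KontsevichZagierPeriods.KontsevichZagierPeriods.Theorems.SymplecticScissorsPlanarSAZylevStubTeCalc
import Summits.KontsevichZagierPeriods.KontsevichZagierPeriods.Theorems.SymplecticScissorsPlanarSAZylevStubTeGlue
import Summits.KontsevichZagierPeriods.KontsevichZagierPeriods.Theorems.SymplecticScissorsPlanarSAZylevStubMosaic
import Summits.KontsevichZagierPeriods.KontsevichZagierPeriods.Theorems.SymplecticScissorsPlanarSAZylevStubGroundCell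
import Summits.KontsevichZagierPeriods.KontsevichZagierPeriods.Theorems.SymplecticScissorsPlanarSAZylevStubGroundLast
import Summits.KontsevichZagierPeriods.KontsevichZagierPeriods.Theorems.SymplecticScissorsPlanarSAZylevStubDownset
import Summits.KontsevichZagierPeriods.KontsevichZagierPeriods.Theorems.SymplecticScissorsPlanarSAZylevEquidec
import Summits.KontsevichZagierPeriods.KontsevichZagierPeriods.Theorems.SymplecticScissorsPlanarSAZylevCancel
import Summits.KontsevichZagierPeriods.KontsevichZagierPeriods.Theorems.SymplecticScissorsPlanarSAZylevDecode

/-!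
# Crux `SymplecticScissors.PlanarSAZylev` (stmt-KontsevichZagierPeriods-9848) — line `reservoir-peeling`,
closing composition

**Planar semialgebraic Zylev.** If `[r] − [r']` lies in the planar set-chain group (the subgroup of
the Kontsevich–Zagier formal group generated by domain additivity and change of variables among
planar integrand-`1` representations), then `r` and `r'` are equidecomposable: full-measure
`ℚ`-semialgebraic restrictions `s ⊆ r`, `s' ⊆ r'` with `[s] − [s']` ONE change-of-variables
instance.

Composition (`stub_assembly`, then `PlanarSAZylev_of`), with the pseudogroup equivalence `E`
instantiated by its pinned definition:
* stubs `stub_teSymm`, `stub_teCalc`, `stub_teGlue` — `E` is an equivalence relation preserving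
  area, with 2 × 2 refinement and gluing;
* `stub_mosaic` — Boltianskii's mosaic lemma (strict comparability);
* `stub_groundCell`, `stub_groundLast`, `stub_downset` — bounded models (`assembly_compress`);
* `assembly_planarCancel` — the quotient of bounded `ℚ`-regions by `E`, with disjoint union, is a
  measured refinement monoid, hence CANCELLATIVE (Zylev–Sah peeling);
* `assembly_decode` — the class map into `K₀` kills the planar set-chain group, so cancellativity
  gives `E r.domain r'.domain`;
* `assembly_bridge` — an `E`-instance between the domains is one `changeOfVariablesRel` instance
  between full-measure restrictions.
The monoid itself is built here, locally, as a `Quotient` (no new definitions in the tree).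

Disproof used (Cruxes/PlanarSAZylev/Disproof.lean): the group hypothesis is consumed once
(`assembly_decode`); integrand `= 1` gives finite area and `|det| = 1`; everything is modulo null
sets (the witnesses live on open co-null parts), as `planarSAZylev_false_exact` demands.
[cite: Boltianskii1978, §16 Thm 22]
-/

noncomputable section

open MeasureTheory Set
open Literature.NumberTheory.Transcendental Literature.ModelTheory.ExponentialFields

namespace Summit.KontsevichZagierPeriods.SymplecticScissors.PlanarSAZylev

/-- **Bridge.** An instance of the pinned pseudogroup equivalence between the domains of two
planar integrand-`1` representations is ONE change-of-variables instance of the Kontsevich–Zagier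
calculus between full-measure `ℚ`-semialgebraic restrictions (`KZ.IntegralRep.restrict`; the
within-derivative is `fderiv` on the open piece, and `1 = 1 · |det|`). [folklore] -/
theorem assembly_bridge (E : Set (Fin 2 → ℝ) → Set (Fin 2 → ℝ) → Prop)
    (HE : ∀ A B : Set (Fin 2 → ℝ), E A B ↔
        ∃ (U : Set (Fin 2 → ℝ)) (Φ : (Fin 2 → ℝ) → (Fin 2 → ℝ)),
          U ⊆ A ∧ IsSemialgebraic ℚ U ∧ IsOpen U ∧ volume (A \ U) = 0 ∧
          IsSemialgebraicMapOn ℚ U Φ ∧ ContDiffOn ℝ 1 Φ U ∧ InjOn Φ U ∧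
          (∀ p ∈ U, |(fderiv ℝ Φ p).det| = 1) ∧ Φ '' U ⊆ B ∧ volume (B \ Φ '' U) = 0)
    (r r' : KZ.IntegralRep 2) (h1 : ∀ p ∈ r.domain, r.integrand p = 1)
    (h1' : ∀ p ∈ r'.domain, r'.integrand p = 1) (h : E r.domain r'.domain) :
    ∃ (s s' : KZ.IntegralRep 2), s.domain ⊆ r.domain ∧ volume (r.domain \ s.domain) = 0 ∧
      s'.domain ⊆ r'.domain ∧ volume (r'.domain \ s'.domain) = 0 ∧
      (∀ p ∈ s.domain, s.integrand p = 1) ∧ (∀ p ∈ s'.domain, s'.integrand p = 1) ∧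
      KZ.of s - KZ.of s' ∈ KZ.changeOfVariablesRel := by
  obtain ⟨U, Φ, hU, hUsa, hUo, hAU, hΦsa, hΦC1, hinj, hdet, hΦB, hBΦ⟩ := (HE _ _).1 h
  have hVsa : IsSemialgebraic ℚ (Φ '' U) :=
    IsSemialgebraicMapOn.isSemialgebraic_image_holds hΦsa subset_rfl hUsa
  refine ⟨r.restrict U hUsa hU, r'.restrict (Φ '' U) hVsa hΦB, hU, hAU, hΦB, hBΦ,
    fun p hp => h1 p (hU hp), fun p hp => h1' p (hΦB hp), ?_⟩
  have hdiff : DifferentiableOn ℝ Φ U := hΦC1.differentiableOn one_ne_zero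
  refine ⟨2, r.restrict U hUsa hU, r'.restrict (Φ '' U) hVsa hΦB, Φ, fun x => fderiv ℝ Φ x, hΦsa,
    fun x hx => ?_, hinj, rfl, fun x hx => ?_, rfl⟩
  · exact ((hdiff x hx).differentiableAt (hUo.mem_nhds hx)).hasFDerivAt.hasFDerivWithinAt
  · show r.integrand x = r'.integrand (Φ x) * |(fderiv ℝ Φ x).det|
    rw [h1 x (hU hx), h1' (Φ x) (hΦB ⟨x, hx, rfl⟩), hdet x hx, one_mul]

/-- **Assembly** (stub `stub_assembly` of the line): from the seven geometric stubs, the crux.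
See the module docstring for the composition. [cite: Boltianskii1978, §16 Thm 22] -/
theorem stub_assembly :
    (∀ (E : Set (Fin 2 → ℝ) → Set (Fin 2 → ℝ) → Prop),
      (∀ A B : Set (Fin 2 → ℝ), E A B ↔
        ∃ (U : Set (Fin 2 → ℝ)) (Φ : (Fin 2 → ℝ) → (Fin 2 → ℝ)),
          U ⊆ A ∧ IsSemialgebraic ℚ U ∧ IsOpen U ∧ volume (A \ U) = 0 ∧
          IsSemialgebraicMapOn ℚ U Φ ∧ ContDiffOn ℝ 1 Φ U ∧ InjOn Φ U ∧
          (∀ p ∈ U, |(fderiv ℝ Φ p).det| = 1) ∧ Φ '' U ⊆ B ∧ volume (B \ Φ '' U) = 0) →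
      ∀ A B : Set (Fin 2 → ℝ), E A B → E B A) →
    (∀ (E : Set (Fin 2 → ℝ) → Set (Fin 2 → ℝ) → Prop),
      (∀ A B : Set (Fin 2 → ℝ), E A B ↔
        ∃ (U : Set (Fin 2 → ℝ)) (Φ : (Fin 2 → ℝ) → (Fin 2 → ℝ)),
          U ⊆ A ∧ IsSemialgebraic ℚ U ∧ IsOpen U ∧ volume (A \ U) = 0 ∧
          IsSemialgebraicMapOn ℚ U Φ ∧ ContDiffOn ℝ 1 Φ U ∧ InjOn Φ U ∧
          (∀ p ∈ U, |(fderiv ℝ Φ p).det| = 1) ∧ Φ '' U ⊆ B ∧ volume (B \ Φ '' U) = 0) →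
      (∀ A B C : Set (Fin 2 → ℝ), E A B → E B C → E A C) ∧
      (∀ A B : Set (Fin 2 → ℝ), E A B → volume A = volume B) ∧
      (∀ (A B : Fin 2 → Set (Fin 2 → ℝ)), (∀ i, IsSemialgebraic ℚ (A i)) →
        (∀ j, IsSemialgebraic ℚ (B j)) → Disjoint (A 0) (A 1) → Disjoint (B 0) (B 1) →
        E (A 0 ∪ A 1) (B 0 ∪ B 1) →
        ∃ C D : Fin 2 → Fin 2 → Set (Fin 2 → ℝ),
          (∀ i j, IsSemialgebraic ℚ (C i j) ∧ IsSemialgebraic ℚ (D i j) ∧ C i j ⊆ A i ∧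
            D i j ⊆ B j ∧ E (C i j) (D i j)) ∧
          (∀ i, Disjoint (C i 0) (C i 1) ∧ volume (A i \ (C i 0 ∪ C i 1)) = 0) ∧
          (∀ j, Disjoint (D 0 j) (D 1 j) ∧ volume (B j \ (D 0 j ∪ D 1 j)) = 0))) →
    (∀ (E : Set (Fin 2 → ℝ) → Set (Fin 2 → ℝ) → Prop),
      (∀ A B : Set (Fin 2 → ℝ), E A B ↔
        ∃ (U : Set (Fin 2 → ℝ)) (Φ : (Fin 2 → ℝ) → (Fin 2 → ℝ)),
          U ⊆ A ∧ IsSemialgebraic ℚ U ∧ IsOpen U ∧ volume (A \ U) = 0 ∧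
          IsSemialgebraicMapOn ℚ U Φ ∧ ContDiffOn ℝ 1 Φ U ∧ InjOn Φ U ∧
          (∀ p ∈ U, |(fderiv ℝ Φ p).det| = 1) ∧ Φ '' U ⊆ B ∧ volume (B \ Φ '' U) = 0) →
      ∀ A₁ A₂ B₁ B₂ : Set (Fin 2 → ℝ), volume (A₁ ∩ A₂) = 0 → Disjoint B₁ B₂ →
        E A₁ B₁ → E A₂ B₂ → E (A₁ ∪ A₂) (B₁ ∪ B₂)) →
    (∀ (E : Set (Fin 2 → ℝ) → Set (Fin 2 → ℝ) → Prop),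
      (∀ A B : Set (Fin 2 → ℝ), E A B ↔
        ∃ (U : Set (Fin 2 → ℝ)) (Φ : (Fin 2 → ℝ) → (Fin 2 → ℝ)),
          U ⊆ A ∧ IsSemialgebraic ℚ U ∧ IsOpen U ∧ volume (A \ U) = 0 ∧
          IsSemialgebraicMapOn ℚ U Φ ∧ ContDiffOn ℝ 1 Φ U ∧ InjOn Φ U ∧
          (∀ p ∈ U, |(fderiv ℝ Φ p).det| = 1) ∧ Φ '' U ⊆ B ∧ volume (B \ Φ '' U) = 0) →
      (∀ A₁ A₂ B₁ B₂ : Set (Fin 2 → ℝ), volume (A₁ ∩ A₂) = 0 → Disjoint B₁ B₂ →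
        E A₁ B₁ → E A₂ B₂ → E (A₁ ∪ A₂) (B₁ ∪ B₂)) →
      (∀ A B C : Set (Fin 2 → ℝ), E A B → E B C → E A C) →
      ∀ A B : Set (Fin 2 → ℝ), IsSemialgebraic ℚ A → IsSemialgebraic ℚ B →
        Bornology.IsBounded A → Bornology.IsBounded B → volume B < volume A →
        ∃ W : Set (Fin 2 → ℝ), W ⊆ A ∧ IsSemialgebraic ℚ W ∧ E B W) →
    (∀ (E : Set (Fin 2 → ℝ) → Set (Fin 2 → ℝ) → Prop),
      (∀ A B : Set (Fin 2 → ℝ), E A B ↔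
        ∃ (U : Set (Fin 2 → ℝ)) (Φ : (Fin 2 → ℝ) → (Fin 2 → ℝ)),
          U ⊆ A ∧ IsSemialgebraic ℚ U ∧ IsOpen U ∧ volume (A \ U) = 0 ∧
          IsSemialgebraicMapOn ℚ U Φ ∧ ContDiffOn ℝ 1 Φ U ∧ InjOn Φ U ∧
          (∀ p ∈ U, |(fderiv ℝ Φ p).det| = 1) ∧ Φ '' U ⊆ B ∧ volume (B \ Φ '' U) = 0) →
      (∀ A₁ A₂ B₁ B₂ : Set (Fin 2 → ℝ), volume (A₁ ∩ A₂) = 0 → Disjoint B₁ B₂ →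
        E A₁ B₁ → E A₂ B₂ → E (A₁ ∪ A₂) (B₁ ∪ B₂)) →
      (∀ A B C : Set (Fin 2 → ℝ), E A B → E B C → E A C) →
      (∀ A A' : Set (Fin 2 → ℝ), A' ⊆ A → IsSemialgebraic ℚ A' → volume (A \ A') = 0 →
        E A A' ∧ E A' A) →
      (∀ (k : ℕ) (C : Set (Fin 1 → ℝ)) (f g : Fin k → (Fin 1 → ℝ) → ℝ),
        IsOpen C → IsSemialgebraic ℚ C →
        (∀ i, IsSemialgebraicFunOn ℚ C (f i)) → (∀ i, IsSemialgebraicFunOn ℚ C (g i)) →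
        (∀ i, ContinuousOn (f i) C) → (∀ i, ContinuousOn (g i) C) →
        (∀ i, ∀ x ∈ C, f i x < g i x) →
        (∀ i i', i < i' → ∀ x ∈ C, g i x ≤ f i' x) →
        E (⋃ i, {z : Fin 2 → ℝ | Fin.init z ∈ C ∧ f i (Fin.init z) < z (Fin.last 1) ∧
              z (Fin.last 1) < g i (Fin.init z)})
          {z : Fin 2 → ℝ | Fin.init z ∈ C ∧ 0 < z (Fin.last 1) ∧
              z (Fin.last 1) < ∑ i, (g i (Fin.init z) - f i (Fin.init z))}) →
      ∀ S : Set (Fin 2 → ℝ), IsSemialgebraic ℚ S → volume S ≠ ⊤ →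
        E S (Grounding.groundLast S)) →
    (∀ (E : Set (Fin 2 → ℝ) → Set (Fin 2 → ℝ) → Prop),
      (∀ A B : Set (Fin 2 → ℝ), E A B ↔
        ∃ (U : Set (Fin 2 → ℝ)) (Φ : (Fin 2 → ℝ) → (Fin 2 → ℝ)),
          U ⊆ A ∧ IsSemialgebraic ℚ U ∧ IsOpen U ∧ volume (A \ U) = 0 ∧
          IsSemialgebraicMapOn ℚ U Φ ∧ ContDiffOn ℝ 1 Φ U ∧ InjOn Φ U ∧
          (∀ p ∈ U, |(fderiv ℝ Φ p).det| = 1) ∧ Φ '' U ⊆ B ∧ volume (B \ Φ '' U) = 0) →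
      (∀ A₁ A₂ B₁ B₂ : Set (Fin 2 → ℝ), volume (A₁ ∩ A₂) = 0 → Disjoint B₁ B₂ →
        E A₁ B₁ → E A₂ B₂ → E (A₁ ∪ A₂) (B₁ ∪ B₂)) →
      ∀ (k : ℕ) (C : Set (Fin 1 → ℝ)) (f g : Fin k → (Fin 1 → ℝ) → ℝ),
        IsOpen C → IsSemialgebraic ℚ C →
        (∀ i, IsSemialgebraicFunOn ℚ C (f i)) → (∀ i, IsSemialgebraicFunOn ℚ C (g i)) →
        (∀ i, ContinuousOn (f i) C) → (∀ i, ContinuousOn (g i) C) →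
        (∀ i, ∀ x ∈ C, f i x < g i x) →
        (∀ i i', i < i' → ∀ x ∈ C, g i x ≤ f i' x) →
        E (⋃ i, {z : Fin 2 → ℝ | Fin.init z ∈ C ∧ f i (Fin.init z) < z (Fin.last 1) ∧
              z (Fin.last 1) < g i (Fin.init z)})
          {z : Fin 2 → ℝ | Fin.init z ∈ C ∧ 0 < z (Fin.last 1) ∧
              z (Fin.last 1) < ∑ i, (g i (Fin.init z) - f i (Fin.init z))}) →
    (∀ (E : Set (Fin 2 → ℝ) → Set (Fin 2 → ℝ) → Prop),
      (∀ A B : Set (Fin 2 → ℝ), E A B ↔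
        ∃ (U : Set (Fin 2 → ℝ)) (Φ : (Fin 2 → ℝ) → (Fin 2 → ℝ)),
          U ⊆ A ∧ IsSemialgebraic ℚ U ∧ IsOpen U ∧ volume (A \ U) = 0 ∧
          IsSemialgebraicMapOn ℚ U Φ ∧ ContDiffOn ℝ 1 Φ U ∧ InjOn Φ U ∧
          (∀ p ∈ U, |(fderiv ℝ Φ p).det| = 1) ∧ Φ '' U ⊆ B ∧ volume (B \ Φ '' U) = 0) →
      ∀ D : Set (Fin 2 → ℝ), IsSemialgebraic ℚ D → volume D ≠ ⊤ →
        (∀ x ∈ D, ∀ i, 0 < x i) →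
        (∀ x ∈ D, ∀ y : Fin 2 → ℝ, (∀ i, 0 < y i ∧ y i ≤ x i) → y ∈ D) →
        ∃ B : Set (Fin 2 → ℝ), IsSemialgebraic ℚ B ∧ Bornology.IsBounded B ∧ E D B) →
    Summit.KontsevichZagierPeriods.KontsevichZagierPeriods.Theses.SymplecticScissors.PlanarSAZylev := by
  intro hsymm hcalc hglue hmosaic hground hcell hdownset r r' h1 h1' hG
  classical
  -- instantiate the pinned relation
  set E : Set (Fin 2 → ℝ) → Set (Fin 2 → ℝ) → Prop := fun A B =>
    ∃ (U : Set (Fin 2 → ℝ)) (Φ : (Fin 2 → ℝ) → (Fin 2 → ℝ)),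
      U ⊆ A ∧ IsSemialgebraic ℚ U ∧ IsOpen U ∧ volume (A \ U) = 0 ∧
      IsSemialgebraicMapOn ℚ U Φ ∧ ContDiffOn ℝ 1 Φ U ∧ InjOn Φ U ∧
      (∀ p ∈ U, |(fderiv ℝ Φ p).det| = 1) ∧ Φ '' U ⊆ B ∧ volume (B \ Φ '' U) = 0 with hEdef
  have HE : ∀ A B : Set (Fin 2 → ℝ), E A B ↔
      ∃ (U : Set (Fin 2 → ℝ)) (Φ : (Fin 2 → ℝ) → (Fin 2 → ℝ)),
        U ⊆ A ∧ IsSemialgebraic ℚ U ∧ IsOpen U ∧ volume (A \ U) = 0 ∧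
        IsSemialgebraicMapOn ℚ U Φ ∧ ContDiffOn ℝ 1 Φ U ∧ InjOn Φ U ∧
        (∀ p ∈ U, |(fderiv ℝ Φ p).det| = 1) ∧ Φ '' U ⊆ B ∧ volume (B \ Φ '' U) = 0 :=
    fun A B => Iff.rfl
  have symm := hsymm E HE
  obtain ⟨trans, vol, refine⟩ := hcalc E HE
  have glue := hglue E HE
  have mosaic := hmosaic E HE glue trans
  have cell := hcell E HE glue
  have sub : ∀ A A' : Set (Fin 2 → ℝ), A' ⊆ A → IsSemialgebraic ℚ A' → volume (A \ A') = 0 →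
      E A A' ∧ E A' A := fun A A' h hA' hn => assembly_subConull E HE h hA' hn
  have ground := hground E HE glue trans sub cell
  have downset := hdownset E HE
  have compress : ∀ S : Set (Fin 2 → ℝ), IsSemialgebraic ℚ S → volume S ≠ ⊤ →
      ∃ K : Set (Fin 2 → ℝ), IsSemialgebraic ℚ K ∧ Bornology.IsBounded K ∧ E S K :=
    fun S hS hv => assembly_compress E HE trans ground downset hS hv
  -- the monoid of bounded regions modulo `E`
  let X := {A : Set (Fin 2 → ℝ) // IsSemialgebraic ℚ A ∧ Bornology.IsBounded A}
  let St : Setoid X := ⟨fun A B => E A.1 B.1,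
    ⟨fun A => assembly_refl E HE A.2.1, fun h => symm _ _ h, fun h h' => trans _ _ _ h h'⟩⟩
  -- separated copies
  have hsh : ∀ A B : X, ∃ q : Fin 2 → ℚ,
      Disjoint A.1 ((fun x => x + fun i => (q i : ℝ)) '' B.1) :=
    fun A B => assembly_exists_shift A.2.2 B.2.2
  have hshiftX : ∀ A B : X, ∃ C : X, Disjoint A.1 C.1 ∧ E B.1 C.1 := by
    intro A B
    obtain ⟨q, hq⟩ := hsh A B
    have hvq : ∀ i, (fun i => (q i : ℝ)) i = q i := fun i => rfl
    refine ⟨⟨(fun x => x + fun i => (q i : ℝ)) '' B.1,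
      mosaic_isSemialgebraic_translate B.2.1 _ q hvq, ?_⟩, hq,
      mosaic_translate E HE B.2.1 _ q hvq⟩
    rw [← Set.add_singleton]
    exact B.2.2.add Bornology.isBounded_singleton
  choose sh hsh_disj hsh_E using hshiftX
  let addX : X → X → X := fun A B => ⟨A.1 ∪ (sh A B).1, A.2.1.union (sh A B).2.1,
    A.2.2.union (sh A B).2.2⟩
  -- `E` between separated copies
  have hcopies : ∀ {B B' : X} (C C' : X), E B.1 B'.1 → E B.1 C.1 → E B'.1 C'.1 → E C.1 C'.1 :=
    fun C C' h hC hC' => trans _ _ _ (symm _ _ hC) (trans _ _ _ h hC')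
  have hadd_wd : ∀ A₁ B₁ A₂ B₂ : X, E A₁.1 A₂.1 → E B₁.1 B₂.1 →
      E (addX A₁ B₁).1 (addX A₂ B₂).1 := by
    intro A₁ B₁ A₂ B₂ hA hB
    refine glue _ _ _ _ ?_ (hsh_disj A₂ B₂) hA (hcopies _ _ hB (hsh_E A₁ B₁) (hsh_E A₂ B₂))
    rw [(hsh_disj A₁ B₁).inter_eq, measure_empty]
  let Mq := Quotient St
  let addQ : Mq → Mq → Mq := Quotient.map₂ addX fun A₁ A₂ hA B₁ B₂ hB => hadd_wd A₁ B₁ A₂ B₂ hA hB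
  let zeroQ : Mq := Quotient.mk St ⟨∅, isSemialgebraic_empty, Bornology.isBounded_empty⟩
  have haddQ : ∀ A B : X, addQ (Quotient.mk St A) (Quotient.mk St B) =
      Quotient.mk St (addX A B) := fun A B => rfl
  have hsound : ∀ {A B : X}, E A.1 B.1 → Quotient.mk St A = Quotient.mk St B :=
    fun h => Quotient.sound h
  -- class of a disjoint union
  have hmk_add' : ∀ A B : X, Disjoint A.1 B.1 → addQ (Quotient.mk St A) (Quotient.mk St B)
      = Quotient.mk St ⟨A.1 ∪ B.1, A.2.1.union B.2.1, A.2.2.union B.2.2⟩ := by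
    intro A B h
    rw [haddQ]
    apply hsound
    refine glue _ _ _ _ ?_ h (assembly_refl E HE A.2.1) (symm _ _ (hsh_E A B))
    rw [(hsh_disj A B).inter_eq, measure_empty]
  letI instZero : Zero Mq := ⟨zeroQ⟩
  letI instAdd : Add Mq := ⟨addQ⟩
  letI inst : AddCommMonoid Mq :=
    { add := addQ
      zero := zeroQ
      nsmul := nsmulRec
      nsmul_zero := fun _ => rfl
      nsmul_succ := fun _ _ => rfl
      add_assoc := by
        rintro ⟨A⟩ ⟨B⟩ ⟨C⟩
        show addQ (addQ (Quotient.mk St A) (Quotient.mk St B)) (Quotient.mk St C) =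
          addQ (Quotient.mk St A) (addQ (Quotient.mk St B) (Quotient.mk St C))
        -- separated copies `B'` of `B` (off `A`) and `C'` of `C` (off `A ∪ B'`)
        set B' : X := sh A B with hB'
        set C' : X := sh (addX A B) C with hC'
        have hBB' : (Quotient.mk St B : Mq) = Quotient.mk St B' := hsound (hsh_E A B)
        have hCC' : (Quotient.mk St C : Mq) = Quotient.mk St C' := hsound (hsh_E (addX A B) C)
        have hAB' : Disjoint A.1 B'.1 := hsh_disj A B
        have hABC' : Disjoint (A.1 ∪ B'.1) C'.1 := hsh_disj (addX A B) C
        have hB'C' : Disjoint B'.1 C'.1 := Disjoint.mono_left subset_union_right hABC'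
        have hA_B'C' : Disjoint A.1 (B'.1 ∪ C'.1) :=
          Disjoint.union_right hAB' (Disjoint.mono_left subset_union_left hABC')
        rw [hBB', hCC', hmk_add' A B' hAB', hmk_add' _ C' hABC', hmk_add' B' C' hB'C',
          hmk_add' A _ hA_B'C']
        congr 1
        exact Subtype.ext (union_assoc _ _ _)
      zero_add := by
        rintro ⟨A⟩
        show addQ zeroQ (Quotient.mk St A) = Quotient.mk St A
        rw [hmk_add' _ A (empty_disjoint _)]
        congr 1
        exact Subtype.ext (empty_union _)
      add_zero := by
        rintro ⟨A⟩
        show addQ (Quotient.mk St A) zeroQ = Quotient.mk St A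
        rw [hmk_add' A _ (disjoint_empty _)]
        congr 1
        exact Subtype.ext (union_empty _)
      add_comm := by
        rintro ⟨A⟩ ⟨B⟩
        show addQ (Quotient.mk St A) (Quotient.mk St B) = addQ (Quotient.mk St B) (Quotient.mk St A)
        set B' : X := sh A B with hB'
        have hBB' : (Quotient.mk St B : Mq) = Quotient.mk St B' := hsound (hsh_E A B)
        have hAB' : Disjoint A.1 B'.1 := hsh_disj A B
        rw [hBB', hmk_add' A B' hAB', hmk_add' B' A hAB'.symm]
        congr 1
        exact Subtype.ext (union_comm _ _) }
  -- the presentation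
  have hmk_eq : ∀ A B : X, (Quotient.mk St A : Mq) = Quotient.mk St B ↔ E A.1 B.1 :=
    fun A B => Quotient.eq (r := St)
  have hmk_add : ∀ A B : X, Disjoint A.1 B.1 → (Quotient.mk St A : Mq) + Quotient.mk St B
      = Quotient.mk St ⟨A.1 ∪ B.1, A.2.1.union B.2.1, A.2.2.union B.2.2⟩ := hmk_add'
  have hmk_zero : (Quotient.mk St ⟨∅, isSemialgebraic_empty, Bornology.isBounded_empty⟩ : Mq) = 0 :=
    rfl
  have hmk_surj : Function.Surjective (Quotient.mk St : X → Mq) := Quotient.mk_surjective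
  have hcancel : ∀ a b c : Mq, a + c = b + c → a = b :=
    assembly_planarCancel E HE symm vol refine mosaic (Quotient.mk St) hmk_eq hmk_add hmk_zero
      hmk_surj
  have hdec : E r.domain r'.domain :=
    assembly_decode E HE symm trans glue compress (Quotient.mk St) hmk_eq hmk_add hcancel
      r r' h1 h1' hG
  exact assembly_bridge E HE r r' h1 h1' hdec

/-- **The line closes the crux**: composition of the eight stubs. -/
theorem PlanarSAZylev_of :
    Summit.KontsevichZagierPeriods.KontsevichZagierPeriods.Theses.SymplecticScissors.PlanarSAZylev :=
  stub_assembly stub_teSymm stub_teCalc stub_teGlue stub_mosaic stub_groundLast stub_groundCell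
    stub_downset

end Summit.KontsevichZagierPeriods.SymplecticScissors.PlanarSAZylev
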